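import Summits.HodgeConjecture.HodgeConjecture.Theorems.K2E1bU21ModelIntertwinerBasis   -- ★ 5b first half (K2E4-p10 (g3)): `linearCombination_vec`, `comp_Xa … comp_Hb`, `centre_apply`
import HarnessLib

/-!
# K2 ∕ E1b · 8b-αᵤ road FILE 5b «THE MODEL INTERTWINER» (row αᵤ-5b, HEAD): an injective linear map `𝒟.V → V`, `u^k_{n,m} ↦ (−f)^{k−1} u_{n,m}`, from the
# datum of a `(𝔤, K)`-module of `U(2,1)` to the module, intertwining the complexified structure of record with the complexified action on all nine units

HCML Track B «K2-LIT», cell `hodgecm-mathlib`, crux H413 = stmt-HodgeConjecture-24833 (supports-only helper; closes nothing by itself).  Socket 8b-αᵤ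
`sig_K2E1bModelOfRecordCohUnitary`; DEAL (D-αᵤ5b) K2E1b-plan (g4) → K2E4-p10 (g3) 2026-09-04T04:27:44Z (+ K2E1b-r01 (g4) pre-read 04:30:22Z: injectivity NOT by
torus weights — they collide along `(n+2j, m, k+j)` — here by the submodule lattice instead).  THEOREMS ONLY (the intertwiner is an `∃`; no `def`, no `sorry`,
no instance declaration, no notation).

## The statement (`exists_intertwiner_of_datum`)

For the datum `𝒟` and witness family `u` of ★ `exists_datum` (its clauses (i) labels∕membership, (ii) `S ↔ u ≠ 0`, (iv) strings, (v) Theorem 1) of `(𝔤, K)`-module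
data `ρ𝔤` of `U(2,1)` on `V` at central label `e`: `∃ Φ : 𝒟.V →ₗ[ℂ] V`, INJECTIVE, with `Φ (𝒟.vec n m k) = (−f)^{k−1} (u n m)` on the admissible labels and
`Φ (ρ_ℂ^{σOfRecord 𝒟 e}(E_{ij}) x) = ρ_ℂ(E_{ij}) (Φ x)` for all nine matrix units `E_{ij}` of `𝔤𝔩(Fin 2 ⊕ Fin 1, ℂ)` — token for token the `T`, `hT` wanted by
★ `IsGKModule.areGKEquivalent_of_lieEquiv` once surjectivity is added (file 5).

## The proof

`Φ := Finsupp.linearCombination` on Kovačević's basis (first half, `linearCombination_vec`).  UNITS: by the twist dictionary ★ `upqLieC_σOfRecord_single`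
(`ρ_ℂ^σ(E_{ij}) = ρ(E_{ĩj̃}) + δ_{ij}(e∕3)·1`) and ★ `ρfun_E`, the six off-diagonal units are the first half's `comp_Xa … comp_Yb` (module side ★
`u21e∕u21f∕u21E∕u21F_eq_upqLieC_single`), and the three diagonal ones are `comp_Ha`, `comp_Hb` + `centre_apply` (`T₀+T₁+T₂ = e` on the range).  INJECTIVITY:
`ker Φ` is a Lie submodule of `𝒟.V` (the units make it `ρ(E_{ij})`-stable, ★ `rho_eq_sum_single`), so if non-zero it contains a basis vector `u^k_{n,m}`
(★ `SU21SubmoduleLattice.single_mem_of_mem_support`), whose image `(−f)^{k−1} u_{n,m} = ±f^{k−1} u_{n,m}` is non-zero by the string (★ `exists_datum` (iv), `k−1 < n`).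

Sources: [Kovacevic2021] §3 Def. 1, Thm. 1–2, Remark 2; [KnappVogan1995] §II.4, §IV.1; [BorelWallach2000] II §4.1; [Rogawski1990] §12.3 p. 177.
HONEST LABEL: a helper of the 8b-αᵤ road (file 5b); it closes nothing by itself; HC_CM is proved only modulo the 7 printed citations (2 remaining named inputs:
hLiu418 = stmt-HodgeConjecture-24832, h413 = stmt-HodgeConjecture-24833) until rung 0 closes.
-/

-- Mathlib idiom (as in every ★ Kovačević ∕ αᵤ file): commutator bracket on `Module.End ℂ V` and on matrices.
attribute [local instance 100] LieRing.ofAssociativeRing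

set_option autoImplicit false
set_option linter.dupNamespace false

noncomputable section

namespace Summit.HodgeConjecture.HodgeConjecture.Cruxes.H413.K2E1bU21ModelIntertwiner

open Literature.RepresentationTheory Literature.RepresentationTheory.KonnoKonno2007
open Literature.RepresentationTheory.Kovacevic2021 Literature.RepresentationTheory.Kovacevic2021.SU21Datum
open Literature.NumberTheory.Automorphic
open Summit.HodgeConjecture.HodgeConjecture.Cruxes.H413.F0P3bLocalAPacketsDefs
open Summit.HodgeConjecture.HodgeConjecture.Cruxes.H413.F0P3bU21Restriction (rho_eq_sum_single)
open Summit.HodgeConjecture.HodgeConjecture.Cruxes.H413.K2E1bU21Weights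
open Summit.HodgeConjecture.HodgeConjecture.Cruxes.H413.K2E1bU21PActionNormalForm
open Summit.HodgeConjecture.HodgeConjecture.Cruxes.H413.K2E1bCarriersOfRecord
open Summit.HodgeConjecture.HodgeConjecture.Cruxes.H413.K2E1bDatumCubicScalar
open Summit.HodgeConjecture.HodgeConjecture.Cruxes.H413.K2E1bU21ModelIntertwinerBasis

variable {V : Type*} [AddCommGroup V] [Module ℂ V]
  {ρK : Representation ℂ G21.maximalCompact V} (ρ𝔤 : G21.lie →ₗ⁅ℝ⁆ Module.End ℂ V)
  {e : ℤ} {𝒟 : SU21Datum} {u : ℤ → ℤ → V}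

/-! ## §1 The nine units, for any `Φ` with the basis formula -/

section Units

variable
  (hi : ∀ n m : ℤ, u n m ≠ 0 → ∃ w, labelN w = n ∧ labelM w = m ∧ labelE w = e ∧ u n m ∈ hwSpace ρ𝔤 w)
  (hT : ∀ (n m : ℤ) (k : ℕ),
    u21E ρ𝔤 0 (((-u21f ρ𝔤) ^ k) (u n m)) =
        (((n : ℂ) - k) * 𝒟.A n m) • ((-u21f ρ𝔤) ^ k) (u (n + 1) (m + 3)) + ((k : ℂ) * 𝒟.C n m) • ((-u21f ρ𝔤) ^ (k - 1)) (u (n - 1) (m + 3)) ∧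
      u21E ρ𝔤 1 (((-u21f ρ𝔤) ^ k) (u n m)) =
        (-𝒟.A n m) • ((-u21f ρ𝔤) ^ (k + 1)) (u (n + 1) (m + 3)) + 𝒟.C n m • ((-u21f ρ𝔤) ^ k) (u (n - 1) (m + 3)) ∧
      u21F ρ𝔤 1 (((-u21f ρ𝔤) ^ k) (u n m)) =
        (((n : ℂ) - k) * 𝒟.B n m) • ((-u21f ρ𝔤) ^ k) (u (n + 1) (m - 3)) - ((k : ℂ) * 𝒟.D n m) • ((-u21f ρ𝔤) ^ (k - 1)) (u (n - 1) (m - 3)) ∧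
      u21F ρ𝔤 0 (((-u21f ρ𝔤) ^ k) (u n m)) =
        𝒟.B n m • ((-u21f ρ𝔤) ^ (k + 1)) (u (n + 1) (m - 3)) + 𝒟.D n m • ((-u21f ρ𝔤) ^ k) (u (n - 1) (m - 3)))
  {Φ : 𝒟.V →ₗ[ℂ] V} (hΦ : ∀ (n m : ℤ) (j : ℕ), Φ (𝒟.vec n m ((j : ℤ) + 1)) = ((-u21f ρ𝔤) ^ j) (u n m))

include hi hT hΦ in
/-- **THE NINE UNITS**: `Φ ∘ ρ_ℂ^{σOfRecord 𝒟 e}(E_{ij}) = ρ_ℂ(E_{ij}) ∘ Φ` for all `i j : Fin 2 ⊕ Fin 1` (twist dictionary ★ `upqLieC_σOfRecord_single` + ★ `ρfun_E` on the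
datum side; the first half's eight operators and `centre_apply` on the module side). [cite: Kovacevic2021, §3 Thm. 1] [cite: Rogawski1990, §12.3 p. 177] -/
theorem comp_upqLieC_single (i j : Fin 2 ⊕ Fin 1) :
    Φ ∘ₗ upqLieC (σOfRecord 𝒟 e) (Matrix.single i j (1 : ℂ)) = upqLieC ρ𝔤 (Matrix.single i j (1 : ℂ)) ∘ₗ Φ := by
  have hXa := comp_Xa ρ𝔤 hi hΦ
  have hYa := comp_Ya ρ𝔤 hΦ (u := u)
  have hXab := comp_Xab ρ𝔤 hT hΦ
  have hXb := comp_Xb ρ𝔤 hT hΦ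
  have hYab := comp_Yab ρ𝔤 hT hΦ
  have hYb := comp_Yb ρ𝔤 hT hΦ
  have hHa := comp_Ha ρ𝔤 hi hΦ
  have hHb := comp_Hb ρ𝔤 hi hΦ
  have hZ := centre_apply ρ𝔤 hi hΦ
  -- the three diagonal units from `H_α`, `H_β` and the centre
  have diag : ∀ (a b : ℂ) (v : 𝒟.V), Φ ((a • 𝒟.Ha + b • 𝒟.Hb + ((e : ℂ) / 3) • (1 : Module.End ℂ 𝒟.V)) v) =
      ((a + 1 / 3) • upqLieC ρ𝔤 (Matrix.single (Sum.inl 0) (Sum.inl 0) (1 : ℂ)) + (b - a + 1 / 3) •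
        upqLieC ρ𝔤 (Matrix.single (Sum.inl 1) (Sum.inl 1) (1 : ℂ)) + (1 / 3 - b) • upqLieC ρ𝔤 (Matrix.single (Sum.inr 0) (Sum.inr 0) (1 : ℂ))) (Φ v) := by
    intro a b v
    have h1 := LinearMap.congr_fun hHa v
    have h2 := LinearMap.congr_fun hHb v
    simp only [LinearMap.comp_apply, LinearMap.sub_apply] at h1 h2
    have h3 : ((e : ℂ) / 3) • Φ v = (1 / 3 : ℂ) • (upqLieC ρ𝔤 (Matrix.single (Sum.inl 0) (Sum.inl 0) (1 : ℂ)) (Φ v) +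
        upqLieC ρ𝔤 (Matrix.single (Sum.inl 1) (Sum.inl 1) (1 : ℂ)) (Φ v) + upqLieC ρ𝔤 (Matrix.single (Sum.inr 0) (Sum.inr 0) (1 : ℂ)) (Φ v)) := by
      rw [hZ v, smul_smul]; congr 1; ring
    simp only [LinearMap.add_apply, LinearMap.smul_apply, Module.End.one_apply, map_add, map_smul, h1, h2]
    rw [h3]
    module
  rw [upqLieC_σOfRecord_single]
  refine LinearMap.ext fun v => ?_
  rcases i with i | i <;> rcases j with j | j <;> fin_cases i <;> fin_cases j
  all_goals simp only [Fin.zero_eta, Fin.mk_one, Fin.isValue, finSumFinEquiv_inl_zero, finSumFinEquiv_inl_one, finSumFinEquiv_inr_zero,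
    Sum.inl.injEq, reduceCtorEq, if_true, if_false, zero_ne_one, one_ne_zero, zero_smul, add_zero, ρfun_E, LinearMap.comp_apply]
  · -- `E₀₀`
    rw [diag]; congr 1; ext1; simp only [LinearMap.add_apply, LinearMap.smul_apply]; module
  · -- `E₀₁ = X_α`
    rw [u21e_eq_upqLieC_single] at hXa; exact LinearMap.congr_fun hXa v
  · -- `E₁₀ = Y_α`
    rw [u21f_eq_upqLieC_single] at hYa; exact LinearMap.congr_fun hYa v
  · -- `E₁₁`
    rw [diag]; congr 1; ext1; simp only [LinearMap.add_apply, LinearMap.smul_apply]; module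
  · -- `E₀₂ = X_{α+β}`
    rw [u21E_eq_upqLieC_single] at hXab; exact LinearMap.congr_fun hXab v
  · -- `E₁₂ = X_β`
    rw [u21E_eq_upqLieC_single] at hXb; exact LinearMap.congr_fun hXb v
  · -- `E₂₀ = Y_{α+β}`
    rw [u21F_eq_upqLieC_single] at hYab; exact LinearMap.congr_fun hYab v
  · -- `E₂₁ = Y_β`
    rw [u21F_eq_upqLieC_single] at hYb; exact LinearMap.congr_fun hYb v
  · -- `E₂₂`
    rw [diag]; congr 1; ext1; simp only [LinearMap.add_apply, LinearMap.smul_apply]; module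

end Units

/-! ## §2 The head -/

/-- **THE MODEL INTERTWINER** (see the module docstring): an injective linear `Φ : 𝒟.V →ₗ[ℂ] V` with `Φ (u^k_{n,m}) = (−f)^{k−1} u_{n,m}` intertwining the nine
units of the complexified structure of record with the complexified action. [cite: Kovacevic2021, §3 Def. 1, Thm. 1–2, Remark 2] [cite: KnappVogan1995, §II.4]
[cite: Rogawski1990, §12.3 p. 177] -/
theorem exists_intertwiner_of_datum
    (hi : ∀ n m : ℤ, u n m ≠ 0 → ∃ w, labelN w = n ∧ labelM w = m ∧ labelE w = e ∧ u n m ∈ hwSpace ρ𝔤 w)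
    (hS : ∀ n m : ℤ, (n, m) ∈ 𝒟.S ↔ u n m ≠ 0)
    (hstr : ∀ n m : ℤ, u n m ≠ 0 → (u21f ρ𝔤 ^ n.toNat) (u n m) = 0 ∧ ∀ k < n.toNat, (u21f ρ𝔤 ^ k) (u n m) ≠ 0)
    (hT : ∀ (n m : ℤ) (k : ℕ),
      u21E ρ𝔤 0 (((-u21f ρ𝔤) ^ k) (u n m)) =
          (((n : ℂ) - k) * 𝒟.A n m) • ((-u21f ρ𝔤) ^ k) (u (n + 1) (m + 3)) + ((k : ℂ) * 𝒟.C n m) • ((-u21f ρ𝔤) ^ (k - 1)) (u (n - 1) (m + 3)) ∧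
        u21E ρ𝔤 1 (((-u21f ρ𝔤) ^ k) (u n m)) =
          (-𝒟.A n m) • ((-u21f ρ𝔤) ^ (k + 1)) (u (n + 1) (m + 3)) + 𝒟.C n m • ((-u21f ρ𝔤) ^ k) (u (n - 1) (m + 3)) ∧
        u21F ρ𝔤 1 (((-u21f ρ𝔤) ^ k) (u n m)) =
          (((n : ℂ) - k) * 𝒟.B n m) • ((-u21f ρ𝔤) ^ k) (u (n + 1) (m - 3)) - ((k : ℂ) * 𝒟.D n m) • ((-u21f ρ𝔤) ^ (k - 1)) (u (n - 1) (m - 3)) ∧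
        u21F ρ𝔤 0 (((-u21f ρ𝔤) ^ k) (u n m)) =
          𝒟.B n m • ((-u21f ρ𝔤) ^ (k + 1)) (u (n + 1) (m - 3)) + 𝒟.D n m • ((-u21f ρ𝔤) ^ k) (u (n - 1) (m - 3))) :
    ∃ Φ : 𝒟.V →ₗ[ℂ] V, Function.Injective Φ ∧
      (∀ n m k : ℤ, (n, m) ∈ 𝒟.S → 1 ≤ k → k ≤ n → Φ (𝒟.vec n m k) = ((-u21f ρ𝔤) ^ (k - 1).toNat) (u n m)) ∧
      ∀ (i j : Fin 2 ⊕ Fin 1) (x : 𝒟.V), Φ (upqLieC (σOfRecord 𝒟 e) (Matrix.single i j (1 : ℂ)) x) = upqLieC ρ𝔤 (Matrix.single i j (1 : ℂ)) (Φ x) := by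
  let Φ : 𝒟.V →ₗ[ℂ] V := Finsupp.linearCombination ℂ fun t : 𝒟.Idx => ((-u21f ρ𝔤) ^ (t.1.2.2 - 1).toNat) (u t.1.1 t.1.2.1)
  have hΦ : ∀ (n m : ℤ) (j : ℕ), Φ (𝒟.vec n m ((j : ℤ) + 1)) = ((-u21f ρ𝔤) ^ j) (u n m) := linearCombination_vec ρ𝔤 hS hstr
  have units := comp_upqLieC_single ρ𝔤 hi hT hΦ
  have hunit : ∀ (i j : Fin 2 ⊕ Fin 1) (x : 𝒟.V),
      Φ (upqLieC (σOfRecord 𝒟 e) (Matrix.single i j (1 : ℂ)) x) = upqLieC ρ𝔤 (Matrix.single i j (1 : ℂ)) (Φ x) :=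
    fun i j x => LinearMap.congr_fun (units i j) x
  refine ⟨Φ, ?_, fun n m k _ hk _ => ?_, hunit⟩
  · -- injectivity through the submodule lattice
    -- `Φ` intertwines `ρ(E_{ab})` with `ρ_ℂ(E_{ab}) − δ_{ab}(e∕3)`, so `ker Φ` is stable under every `ρ(M)`
    have hE : ∀ (a b : Fin 3) (x : 𝒟.V), Φ x = 0 → Φ (𝒟.ρfun (E a b) x) = 0 := by
      intro a b x hx
      obtain ⟨a, rfl⟩ := (finSumFinEquiv : Fin 2 ⊕ Fin 1 ≃ Fin 3).surjective a
      obtain ⟨b, rfl⟩ := (finSumFinEquiv : Fin 2 ⊕ Fin 1 ≃ Fin 3).surjective b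
      have h1 := hunit a b x
      rw [upqLieC_σOfRecord_single, LinearMap.add_apply, LinearMap.smul_apply, Module.End.one_apply, map_add, map_smul, hx, smul_zero,
        map_zero] at h1
      simpa using h1
    let N : LieSubmodule ℂ (Matrix (Fin 3) (Fin 3) ℂ) 𝒟.V :=
      { (LinearMap.ker Φ : Submodule ℂ 𝒟.V) with
        lie_mem := by
          intro M x hx
          simp only [Submodule.mem_carrier, SetLike.mem_coe, LinearMap.mem_ker] at hx ⊢
          rw [lie_def, ← ρ_apply, rho_eq_sum_single 𝒟.ρ M, LinearMap.sum_apply, map_sum]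
          refine Finset.sum_eq_zero fun p _ => ?_
          rw [LinearMap.smul_apply, map_smul, ρ_apply, hE p.1 p.2 x hx, smul_zero] }
    have hmemN : ∀ x : 𝒟.V, x ∈ N ↔ Φ x = 0 := fun x => LinearMap.mem_ker
    rw [← LinearMap.ker_eq_bot, Submodule.eq_bot_iff]
    intro x hx
    by_contra hx0
    obtain ⟨t, ht⟩ := Finsupp.support_nonempty_iff.2 hx0
    have hsingle : Finsupp.single t (1 : ℂ) ∈ N := single_mem_of_mem_support N ((hmemN x).2 hx) ht
    obtain ⟨⟨n, m, k⟩, hnm, hk, hkn⟩ := t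
    simp only at hnm hk hkn
    have hvec : Φ (𝒟.vec n m k) = 0 := by rw [vec_of_pos n m k ⟨hnm, hk, hkn⟩]; exact (hmemN _).1 hsingle
    obtain ⟨j, rfl⟩ : ∃ j : ℕ, k = (j : ℤ) + 1 := ⟨(k - 1).toNat, by omega⟩
    rw [hΦ] at hvec
    -- `(−f)^j u = (−1)^j f^j u ≠ 0` for `j < n`
    have hsgn : ∀ (k : ℕ) (y : V), ((-u21f ρ𝔤) ^ k) y = ((-1 : ℂ) ^ k) • (u21f ρ𝔤 ^ k) y := by
      intro k y
      induction k with
      | zero => simp only [pow_zero, Module.End.one_apply, one_smul]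
      | succ k ih =>
        rw [pow_succ', Module.End.mul_apply, ih, LinearMap.neg_apply, map_smul, pow_succ' (u21f ρ𝔤) k, Module.End.mul_apply,
          pow_succ (-1 : ℂ) k, mul_neg_one, neg_smul]
    rw [hsgn, smul_eq_zero] at hvec
    rcases hvec with h | h
    · exact (pow_ne_zero j (by norm_num : (-1 : ℂ) ≠ 0)) h
    · exact (hstr n m ((hS n m).1 hnm)).2 j (by omega) h
  · -- the values on the basis
    obtain ⟨j, rfl⟩ : ∃ j : ℕ, k = (j : ℤ) + 1 := ⟨(k - 1).toNat, by omega⟩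
    rw [hΦ]
    congr 2
    simp only [add_sub_cancel_right, Int.toNat_natCast]

end Summit.HodgeConjecture.HodgeConjecture.Cruxes.H413.K2E1bU21ModelIntertwiner

end
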